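import Mathlib.GroupTheory.Sylow
import Mathlib.Algebra.Group.Conj
import Mathlib.Data.Fintype.Lattice
import HarnessLib

/-!
# The maximal normal `p`-subgroup: a non-normal cyclic subgroup of order `p` modulo `O_p(G)`, or a normal Sylow `p`-subgroup;
# the Sylow count `|G| ≥ 2p(p+1)` when a Sylow `p`-subgroup is not normal and the centre has even order

COR-CM (cell `pub-hodgecm2`), binder seat b04 (gen 38), count-neutral own lane «Galois-CM-type classification».  KERNEL ONLY,
Mathlib only: theorems; no definition, no named fact, no `sorry`.  Group-theoretic feeder of `CorCM/GaloisNormalSylow` (gen 38: in a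
GOOD Galois CM field — all primitive CM types nondegenerate — the Sylow `p`-subgroups of `Gal(K/ℚ)` for odd `p` are NORMAL, by
gen 33's «every subgroup of prime order of the Galois group of a GOOD field is normal» applied to the CM quotient by the maximal
normal `p`-subgroup).

THE ARGUMENT.  Let `N ◁ G` be a normal `p`-subgroup of MAXIMAL ORDER (`exists_maximal_normal_isPGroup`).  If `p ∣ [G:N]`, Cauchy's
theorem gives `x̄ ∈ G/N` of order `p`; were `⟨x̄⟩` normal in `G/N`, its preimage would be a normal `p`-subgroup of `G` strictly larger
than `N`.  So **either `p ∤ [G:N]` — and then `N` is the unique (normal) Sylow `p`-subgroup — or `G/N` contains a NON-NORMAL subgroup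
of order `p`** (`exists_nonnormal_mod_of_maximal`, stated with elements: `x ∉ N`, `xᵖ ∈ N`, and `g x g⁻¹ x⁻ᵏ ∉ N` for all `k`).
Likewise a normal Sylow `p`-subgroup of `G/N` lifts (`not_dvd_index_of_maximal_of_quotient`).  Finally the Sylow count: if a Sylow
`p`-subgroup `P` (`p` odd) of a finite group with a central involution is NOT normal, then `n_p ≥ p + 1` and `2p ∣ |N_G(P)|`, so
`|G| ≥ 2p(p+1)` (`card_ge_of_sylow_not_normal`) — which makes gen 33's size condition automatic for `p ≥ 31`.

## References

* [Rotman1995] J. J. Rotman, *An Introduction to the Theory of Groups*, 4th ed., GTM 148, Thm. 4.2 (Cauchy), Thm. 4.12 (Sylow),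
  Ex. 4.11–4.12 (normal Sylow subgroups).

Provenance: Literature home (family `hodge`, namespace `Literature.GroupTheory.NormalSylow`) of the Summits-side `CorCM/GaloisMaximalNormalPSubgroup` (cell `pub-hodgecm2`, COR-CM; all its imports are `Literature/` and Mathlib), which `Literature/` may not import; theorems only, no named fact, no definition. Nothing here bears on `HC_CM`. Lane `lit-hodgefound` (Layer A3: CM types, their Kubota ranks and Galois combinatorics), seat p20.
-/

namespace Literature.GroupTheory.NormalSylow

variable {G : Type*} [Group G]

/-! ## §1 A normal `p`-subgroup of maximal order -/

/-- **A finite group has a normal `p`-subgroup of maximal order** (the subgroup `O_p(G)`; only the maximality of the order is used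
below). [cite: Rotman1995, Thm. 4.12 and Ex. 4.11] -/
theorem exists_maximal_normal_isPGroup (G : Type*) [Group G] [Finite G] (p : ℕ) :
    ∃ N : Subgroup G, N.Normal ∧ IsPGroup p N ∧
      ∀ M : Subgroup G, M.Normal → IsPGroup p M → Nat.card M ≤ Nat.card N := by
  let S := {N : Subgroup G // N.Normal ∧ IsPGroup p N}
  haveI : Nonempty S := ⟨⟨⊥, inferInstance, IsPGroup.of_bot⟩⟩
  obtain ⟨⟨N, hN, hNP⟩, hmax⟩ := Finite.exists_max (fun s : S => Nat.card s.1)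
  exact ⟨N, hN, hNP, fun M hM hMP => hmax ⟨M, hM, hMP⟩⟩

section Prime

variable {p : ℕ} [hp : Fact p.Prime]

omit hp in
/-- The preimage in `G` of a `p`-subgroup of `G/N`, `N` a normal `p`-subgroup, is a `p`-subgroup. [cite: Rotman1995, Thm. 4.12 and Ex. 4.11] -/
theorem isPGroup_comap_mk' (N : Subgroup G) [N.Normal] (hNP : IsPGroup p N) (S : Subgroup (G ⧸ N))
    (hSP : IsPGroup p S) : IsPGroup p (S.comap (QuotientGroup.mk' N)) := by
  intro m
  have hm : QuotientGroup.mk' N m.1 ∈ S := m.2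
  obtain ⟨k, hk⟩ := hSP ⟨_, hm⟩
  have hk' : (QuotientGroup.mk' N m.1) ^ p ^ k = 1 := by
    have := congrArg Subtype.val hk
    simpa using this
  have hmem : m.1 ^ p ^ k ∈ N := by
    rw [← QuotientGroup.eq_one_iff, ← QuotientGroup.mk'_apply, map_pow]
    exact hk'
  obtain ⟨j, hj⟩ := hNP ⟨_, hmem⟩
  refine ⟨k + j, Subtype.ext ?_⟩
  have := congrArg Subtype.val hj
  simpa [pow_add, pow_mul] using this

/-- **Maximal normal `p`-subgroup with `p ∣ [G:N]` ⟹ a NON-NORMAL cyclic subgroup of order `p` in `G/N`**, in elements: some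
`x ∉ N` with `xᵖ ∈ N` and some `g` with `g x g⁻¹ x⁻ᵏ ∉ N` for every `k` (Cauchy in `G/N`; were `⟨x̄⟩ ◁ G/N`, its preimage would be
a larger normal `p`-subgroup). [cite: Rotman1995, Thm. 4.2 and Ex. 4.11] -/
theorem exists_nonnormal_mod_of_maximal [Finite G] (N : Subgroup G) [N.Normal] (hNP : IsPGroup p N)
    (hmax : ∀ M : Subgroup G, M.Normal → IsPGroup p M → Nat.card M ≤ Nat.card N) (hdvd : p ∣ N.index) :
    ∃ x g : G, x ∉ N ∧ x ^ p ∈ N ∧ ∀ k : ℕ, g * x * g⁻¹ * (x ^ k)⁻¹ ∉ N := by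
  classical
  obtain ⟨q, hq⟩ := exists_prime_orderOf_dvd_card' (G := G ⧸ N) p hdvd
  obtain ⟨x, rfl⟩ := QuotientGroup.mk_surjective q
  have hxN : x ∉ N := by
    intro hxN
    have h1 : (QuotientGroup.mk x : G ⧸ N) = 1 := (QuotientGroup.eq_one_iff x).2 hxN
    rw [h1, orderOf_one] at hq
    exact hp.out.one_lt.ne hq
  have hxp : x ^ p ∈ N := by
    rw [← QuotientGroup.eq_one_iff, QuotientGroup.mk_pow, ← hq, pow_orderOf_eq_one]
  by_contra hall
  push Not at hall
  -- then `⟨x̄⟩` is normal in `G/N`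
  set xb : G ⧸ N := QuotientGroup.mk x with hxb
  have hxbp : xb ^ p = 1 := by rw [← hq, pow_orderOf_eq_one]
  have hZ : (Subgroup.zpowers xb).Normal := by
    refine ⟨fun y hy q => ?_⟩
    obtain ⟨j, rfl⟩ := Subgroup.mem_zpowers_iff.1 hy
    obtain ⟨g, rfl⟩ := QuotientGroup.mk_surjective q
    obtain ⟨k, hk⟩ := hall x g hxN hxp
    rw [← conj_zpow]
    refine Subgroup.zpow_mem _ ?_ j
    have hgx : (QuotientGroup.mk (g * x * g⁻¹) : G ⧸ N) = QuotientGroup.mk (x ^ k) := by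
      rw [QuotientGroup.eq_iff_div_mem, div_eq_mul_inv]
      exact hk
    have : (QuotientGroup.mk g : G ⧸ N) * xb * (QuotientGroup.mk g)⁻¹ = xb ^ k := by
      rw [hxb, ← QuotientGroup.mk_mul, ← QuotientGroup.mk_inv, ← QuotientGroup.mk_mul, hgx, QuotientGroup.mk_pow]
    rw [this]
    exact Subgroup.pow_mem _ (Subgroup.mem_zpowers xb) k
  -- its preimage `M` is a normal `p`-subgroup strictly containing `N`
  let M : Subgroup G := (Subgroup.zpowers xb).comap (QuotientGroup.mk' N)
  have hM : M.Normal := hZ.comap _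
  have hMP : IsPGroup p M :=
    isPGroup_comap_mk' N hNP _ (IsPGroup.iff_orderOf.2 fun y => by
      obtain ⟨j, hj⟩ := Subgroup.mem_zpowers_iff.1 y.2
      refine ⟨if y = 1 then 0 else 1, ?_⟩
      split_ifs with hy1
      · rw [hy1, orderOf_one, pow_zero]
      · rw [pow_one]
        have hyp : y ^ p = 1 := Subtype.ext (by
          have : (y : G ⧸ N) ^ p = 1 := by
            rw [← hj, ← zpow_natCast, ← zpow_mul, mul_comm, zpow_mul, zpow_natCast, hxbp, one_zpow]
          simpa using this)
        exact orderOf_eq_prime hyp hy1)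
  have hNM : N ≤ M := fun n hn => by
    change QuotientGroup.mk' N n ∈ Subgroup.zpowers xb
    rw [QuotientGroup.mk'_apply, (QuotientGroup.eq_one_iff n).2 hn]
    exact one_mem _
  have hxM : x ∈ M := by
    change QuotientGroup.mk' N x ∈ Subgroup.zpowers xb
    exact Subgroup.mem_zpowers xb
  have hEq : N = M := Subgroup.eq_of_le_of_card_ge hNM (hmax M hM hMP)
  exact hxN (hEq ▸ hxM)

omit hp in
/-- **A normal Sylow `p`-subgroup of `G/N` lifts**: `N` a normal `p`-subgroup of maximal order and `S ◁ G/N` a normal `p`-subgroup of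
index prime to `p` ⟹ `p ∤ [G:N]` (the preimage of `S` is a normal `p`-subgroup containing `N`, hence equal to it).
[cite: Rotman1995, Ex. 4.11 and Ex. 4.12] -/
theorem not_dvd_index_of_maximal_of_quotient [Finite G] (N : Subgroup G) [N.Normal] (hNP : IsPGroup p N)
    (hmax : ∀ M : Subgroup G, M.Normal → IsPGroup p M → Nat.card M ≤ Nat.card N)
    (S : Subgroup (G ⧸ N)) [hS : S.Normal] (hSP : IsPGroup p S) (hSi : ¬ p ∣ S.index) : ¬ p ∣ N.index := by
  let M : Subgroup G := S.comap (QuotientGroup.mk' N)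
  have hM : M.Normal := hS.comap _
  have hMP : IsPGroup p M := isPGroup_comap_mk' N hNP S hSP
  have hidx : M.index = S.index := Subgroup.index_comap_of_surjective S (QuotientGroup.mk'_surjective N)
  have hNM : N ≤ M := fun n hn => by
    change QuotientGroup.mk' N n ∈ S
    rw [QuotientGroup.mk'_apply, (QuotientGroup.eq_one_iff n).2 hn]
    exact one_mem _
  have hEq : N = M := Subgroup.eq_of_le_of_card_ge hNM (hmax M hM hMP)
  rw [hEq, hidx]
  exact hSi

/-- … in particular if EVERY Sylow `p`-subgroup of `G/N` is normal. [cite: Rotman1995, Thm. 4.12 and Ex. 4.11] -/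
theorem not_dvd_index_of_maximal_of_sylow_quotient_normal [Finite G] (N : Subgroup G) [N.Normal] (hNP : IsPGroup p N)
    (hmax : ∀ M : Subgroup G, M.Normal → IsPGroup p M → Nat.card M ≤ Nat.card N)
    (hq : ∀ Q : Sylow p (G ⧸ N), (Q : Subgroup (G ⧸ N)).Normal) : ¬ p ∣ N.index := by
  obtain ⟨Q⟩ := (inferInstance : Nonempty (Sylow p (G ⧸ N)))
  haveI := hq Q
  exact not_dvd_index_of_maximal_of_quotient N hNP hmax (Q : Subgroup (G ⧸ N)) Q.isPGroup' Q.not_dvd_index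

/-! ## §2 A normal `p`-subgroup of index prime to `p` is THE Sylow `p`-subgroup -/

/-- A normal `p`-subgroup of index prime to `p` is every Sylow `p`-subgroup. [cite: Rotman1995, Thm. 4.12 and Ex. 4.11] -/
theorem coe_sylow_eq_of_not_dvd_index [Finite G] (N : Subgroup G) [hN : N.Normal] (hNP : IsPGroup p N)
    (hi : ¬ p ∣ N.index) (P : Sylow p G) : (P : Subgroup G) = N := by
  have hU : Unique (Sylow p G) := Sylow.unique_of_normal (hNP.toSylow hi) (by simpa using hN)
  haveI : Subsingleton (Sylow p G) := hU.instSubsingleton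
  rw [Subsingleton.elim P (hNP.toSylow hi)]
  rfl

/-- … hence every Sylow `p`-subgroup is normal. [cite: Rotman1995, Thm. 4.12 and Ex. 4.11] -/
theorem sylow_normal_of_not_dvd_index [Finite G] (N : Subgroup G) [hN : N.Normal] (hNP : IsPGroup p N)
    (hi : ¬ p ∣ N.index) (P : Sylow p G) : (P : Subgroup G).Normal := by
  rw [coe_sylow_eq_of_not_dvd_index N hNP hi P]
  exact hN

/-- **Dichotomy**: in a finite group either every Sylow `p`-subgroup is normal, or for the normal `p`-subgroup `N` of maximal order
`p ∣ [G:N]` and `G/N` has a non-normal cyclic subgroup of order `p` (elements `x ∉ N`, `xᵖ ∈ N`, `g x g⁻¹ x⁻ᵏ ∉ N` for all `k`).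
[cite: Rotman1995, Thm. 4.2, Thm. 4.12 and Ex. 4.11] -/
theorem sylow_normal_or_exists_nonnormal_mod (G : Type*) [Group G] [Finite G] (p : ℕ) [Fact p.Prime] :
    (∀ P : Sylow p G, (P : Subgroup G).Normal) ∨
      ∃ N : Subgroup G, N.Normal ∧ IsPGroup p N ∧ (∀ M : Subgroup G, M.Normal → IsPGroup p M → Nat.card M ≤ Nat.card N) ∧
        p ∣ N.index ∧ ∃ x g : G, x ∉ N ∧ x ^ p ∈ N ∧ ∀ k : ℕ, g * x * g⁻¹ * (x ^ k)⁻¹ ∉ N := by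
  obtain ⟨N, hN, hNP, hmax⟩ := exists_maximal_normal_isPGroup G p
  by_cases hdvd : p ∣ N.index
  · exact Or.inr ⟨N, hN, hNP, hmax, hdvd, exists_nonnormal_mod_of_maximal N hNP hmax hdvd⟩
  · exact Or.inl fun P => sylow_normal_of_not_dvd_index N hNP hdvd P

/-! ## §3 The Sylow count: `|G| ≥ 2p(p+1)` when a Sylow `p`-subgroup is not normal and the centre contains an involution -/

/-- **`|G| ≥ 2p(p+1)`**: if `p` is an odd prime, `c` is a central involution of the finite group `G`, and some Sylow `p`-subgroup `P`
is NOT normal, then the number of Sylow `p`-subgroups is `≥ p + 1` (Sylow III) and `2p ∣ |N_G(P)|` (`P ≤ N_G(P) ∋ c`), so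
`2p(p+1) ≤ |G|`. [cite: Rotman1995, Thm. 4.12] -/
theorem card_ge_of_sylow_not_normal [Finite G] (hp2 : p ≠ 2) {c : G} (hcz : ∀ g : G, c * g = g * c) (hcc : c * c = 1)
    (hc1 : c ≠ 1) (P : Sylow p G) (hP : ¬ (P : Subgroup G).Normal) : 2 * p * (p + 1) ≤ Nat.card G := by
  classical
  have hpri := hp.out
  set NP : Subgroup G := Subgroup.normalizer ((P : Subgroup G) : Set G) with hNP
  -- `n_p ≥ p + 1`
  have hn : p + 1 ≤ NP.index := by
    have hne : NP.index ≠ 1 := by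
      rw [Ne, Subgroup.index_eq_one, hNP, Subgroup.normalizer_eq_top_iff]
      exact hP
    have hmod : NP.index % p = 1 := by
      have h := card_sylow_modEq_one p G
      rw [Sylow.card_eq_index_normalizer P] at h
      change NP.index ≡ 1 [MOD p] at h
      rw [h, Nat.mod_eq_of_lt hpri.one_lt]
    have := Nat.div_add_mod NP.index p
    rw [hmod] at this
    by_contra hlt
    have hdiv : NP.index / p = 0 := by
      by_contra h0
      have : p * 1 ≤ p * (NP.index / p) := Nat.mul_le_mul_left p (Nat.pos_of_ne_zero h0)
      omega
    rw [hdiv, mul_zero, zero_add] at this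
    exact hne this.symm
  -- `2p ∣ |N_G(P)|`
  have hPbot : (P : Subgroup G) ≠ ⊥ := by
    intro h
    apply hP
    rw [h]
    infer_instance
  have hpP : p ∣ Nat.card (P : Subgroup G) := by
    rcases P.isPGroup'.card_eq_or_dvd with h | h
    · exact absurd ((Subgroup.eq_bot_iff_card _).2 h) hPbot
    · exact h
  have hcN : c ∈ NP := by
    rw [hNP, Subgroup.mem_normalizer_iff]
    intro h
    rw [hcz h, mul_assoc, mul_inv_cancel, mul_one]
  have h2N : 2 ∣ Nat.card NP := by
    have hord : orderOf c = 2 := orderOf_eq_prime (by rw [pow_two, hcc]) hc1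
    have := orderOf_dvd_natCard (⟨c, hcN⟩ : NP)
    rwa [← Subgroup.orderOf_coe, hord] at this
  have hpN : p ∣ Nat.card NP :=
    hpP.trans (Subgroup.card_dvd_of_le (hNP ▸ Subgroup.le_normalizer))
  have h2p : 2 * p ∣ Nat.card NP :=
    Nat.Coprime.mul_dvd_of_dvd_of_dvd ((Nat.coprime_primes Nat.prime_two hpri).2 (Ne.symm hp2)) h2N hpN
  have hNpos : 0 < Nat.card NP := Nat.card_pos
  have hle : 2 * p ≤ Nat.card NP := Nat.le_of_dvd hNpos h2p
  calc 2 * p * (p + 1) ≤ Nat.card NP * NP.index := Nat.mul_le_mul hle hn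
    _ = Nat.card G := Subgroup.card_mul_index _

end Prime

end Literature.GroupTheory.NormalSylow
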